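import Literature.AlgebraicGeometry.Motives.HodgeThetaSubalgebraUnitaryScalarOnRange
import HarnessLib

/-!
# Weight relations at a minimal base point: the `𝔰𝔩₂`-element `h_X` and the brackets `[h_X, X] = 2X`,
# `[h_X, Y] = Y`, `[h_X, Y†] = −Y†`, `[h_X, h_Y] = 0`

Family `hodge`, layer `Literature/AlgebraicGeometry/Motives` (pure linear algebra over `ℂ`; no geometry). Research
context: cell `pub-hodge-ring2` (HONEST FRAMING: research route conditional on HC_CM; not a corollary; Q11.4-sentence-2
already refuted in dim ≥ 3), Literature lane gen 87 — step 4 of the proof plan for the last `p = 37` cell `(15 | 22)`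
of Ribet's theorem (steps 2, 3: `HodgeThetaSubalgebraUnitarySlotIdentity`, `HodgeThetaSubalgebraUnitaryScalarOnRange`;
plan in the gen-87 README). UNCONDITIONAL; theorems only, no definition, no named fact (D-0026), no `sorry`.

CONTENT (operator algebra; `X, Y` raising with adjoints `X† = Xa`, `Y† = Ya`, `λ = λ_X` the `(X, X)` slot constant):
* `op_scalar`: the two conclusions of `scalar_on_range` give the operator identity `Y X† Y = c · Y`;
* `weight_one_of`: `X X† X = λX`, `Y X† Y = 0`, `(X+Y) X† (X+Y) = λ (X+Y)` ⟹ (II) `X X† Y + Y X† X = λ Y`;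
* `bracket_weight_two` / `bracket_weight_one`: with `h_X = λ⁻¹ (X X† − X† X)`: `[h_X, X] = 2X`, and (II) ⟹ `[h_X, Y] = Y`;
* `slotConstant_real`: `λ` is real (`X X† X = λ X`, `X ≠ 0`, definiteness);
* `bracket_weight_neg_one`: (II) + adjunction + `λ` real ⟹ `[h_X, Y†] = −Y†`;
* `torus_commute`: `[h_X, Y] = Y`, `[h_X, Y†] = −Y†` ⟹ `[h_X, Y Y† − Y† Y] = 0`.
[cite: GoodmanWallachGTM255, §4.1.1, §2.3.1 (𝔰𝔩₂-triples)] [cite: HoffmanKunze1971LinearAlgebra, §8.5]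

## References
* [GoodmanWallachGTM255] R. Goodman, N. R. Wallach, GTM 255 (2009), §2.3.1, §4.1.1.
* [HoffmanKunze1971LinearAlgebra] K. Hoffman, R. Kunze, *Linear Algebra* (1971), §8.5 (adjoints).
-/

noncomputable section

open Module

namespace Literature.AlgebraicGeometry.Motives

namespace HodgeStructure

universe u

variable {W : Type u} [AddCommGroup W] [Module ℂ W]

/-- Operator form of `scalar_on_range`: `Y X† Y = c · Y`. [cite: GoodmanWallachGTM255, §4.1.1] -/
theorem UnitaryLeviSetup.op_scalar {ι : Module.End ℂ W} {Um Up : Submodule ℂ W} (hιι : ι * ι = 1)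
    (hUm : ∀ x, x ∈ Um ↔ ι x = -x) (hUp : ∀ x, x ∈ Up ↔ ι x = x) {Y Xa : Module.End ℂ W} {c : ℂ}
    (h1 : ∀ p ∈ Um.map Y, Y (Xa p) = c • p) (h2 : ∀ v ∈ Up.map Y, Y (Xa v) = c • v) :
    Y * Xa * Y = c • Y := by
  have hιιv : ∀ v, ι (ι v) = v := fun v => by rw [← Module.End.mul_apply, hιι, Module.End.one_apply]
  refine LinearMap.ext fun w => ?_
  have hw : w = (2 : ℂ)⁻¹ • (w + ι w) + (2 : ℂ)⁻¹ • (w - ι w) := by module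
  have hp : (2 : ℂ)⁻¹ • (w + ι w) ∈ Up := (hUp _).2 (by rw [map_smul, map_add, hιιv, add_comm])
  have hm : (2 : ℂ)⁻¹ • (w - ι w) ∈ Um := (hUm _).2 (by rw [map_smul, map_sub, hιιv, ← smul_neg, neg_sub])
  rw [Module.End.mul_apply, Module.End.mul_apply, LinearMap.smul_apply]
  conv_lhs => rw [hw, map_add, map_add, map_add, h2 _ (Submodule.mem_map_of_mem hp),
    h1 _ (Submodule.mem_map_of_mem hm), ← smul_add, ← map_add, ← hw]

/-- (II) from the three operator identities. [cite: GoodmanWallachGTM255, §2.3.1] -/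
theorem UnitaryLeviSetup.weight_one_of {X Y Xa : Module.End ℂ W} {c : ℂ} (hXX : X * Xa * X = c • X)
    (hYY : Y * Xa * Y = 0) (hS : (X + Y) * Xa * (X + Y) = c • (X + Y)) :
    X * Xa * Y + Y * Xa * X = c • Y := by
  have h : (X + Y) * Xa * (X + Y) = X * Xa * X + (X * Xa * Y + Y * Xa * X) + Y * Xa * Y := by
    simp only [add_mul, mul_add]; abel
  rw [h, hXX, hYY, add_zero, smul_add] at hS
  exact add_left_cancel hS

/-- `[h_X, X] = 2 X` for `h_X = λ⁻¹ (X X† − X† X)`. [cite: GoodmanWallachGTM255, §2.3.1] -/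
theorem UnitaryLeviSetup.bracket_weight_two {X Xa : Module.End ℂ W} {c : ℂ} (hc : c ≠ 0)
    (hXX : X * Xa * X = c • X) (hX2 : X * X = 0) :
    (c⁻¹ • (X * Xa - Xa * X)) * X - X * (c⁻¹ • (X * Xa - Xa * X)) = (2 : ℂ) • X := by
  rw [smul_mul_assoc, mul_smul_comm, ← smul_sub, sub_mul, mul_sub, hXX, mul_assoc Xa X X, hX2, mul_zero, sub_zero,
    ← mul_assoc, hX2, zero_mul, zero_sub, sub_neg_eq_add, ← mul_assoc, hXX, ← two_smul ℂ, smul_smul, smul_smul,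
    mul_comm c⁻¹ (2 : ℂ), mul_assoc, inv_mul_cancel₀ hc, mul_one]

/-- `[h_X, Y] = Y` from (II), for raising `X, Y` (`X Y = Y X = 0`). [cite: GoodmanWallachGTM255, §2.3.1] -/
theorem UnitaryLeviSetup.bracket_weight_one {X Y Xa : Module.End ℂ W} {c : ℂ} (hc : c ≠ 0)
    (hXY : X * Y = 0) (hYX : Y * X = 0) (hII : X * Xa * Y + Y * Xa * X = c • Y) :
    (c⁻¹ • (X * Xa - Xa * X)) * Y - Y * (c⁻¹ • (X * Xa - Xa * X)) = Y := by
  rw [smul_mul_assoc, mul_smul_comm, ← smul_sub, sub_mul, mul_sub, mul_assoc Xa X Y, hXY, mul_zero, sub_zero,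
    ← mul_assoc, hYX, zero_mul, zero_sub, sub_neg_eq_add, ← mul_assoc, hII, smul_smul, inv_mul_cancel₀ hc, one_smul]

/-- `[h_X, Y Y† − Y† Y] = 0` from `[h_X, Y] = Y` and `[h_X, Y†] = −Y†`. [cite: GoodmanWallachGTM255, §2.3.1] -/
theorem UnitaryLeviSetup.torus_commute {H Y Ya : Module.End ℂ W} (h1 : H * Y - Y * H = Y)
    (h2 : H * Ya - Ya * H = -Ya) :
    H * (Y * Ya - Ya * Y) - (Y * Ya - Ya * Y) * H = 0 := by
  have e : H * (Y * Ya - Ya * Y) - (Y * Ya - Ya * Y) * H =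
      (H * Y - Y * H) * Ya + Y * (H * Ya - Ya * H) - ((H * Ya - Ya * H) * Y + Ya * (H * Y - Y * H)) := by
    simp only [sub_mul, mul_sub, mul_assoc]; abel
  rw [e, h1, h2, mul_neg, neg_mul, ← sub_eq_add_neg, sub_self, zero_sub, neg_add_eq_sub, sub_self, neg_zero]

/-- The slot constant `λ_X` is real: `X X† X = λ X`, `X ≠ 0`, `s` Hermitian and definite on `P ∋ X w`.
[cite: HoffmanKunze1971LinearAlgebra, §8.5] -/
theorem UnitaryLeviSetup.slotConstant_real {Θ : Module.End ℂ W} {P : Submodule ℂ W} (hP : ∀ x, x ∈ P ↔ Θ x = x)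
    {s : W → W → ℂ} (hsmul : ∀ (c : ℂ) (x y : W), s (c • x) y = c * s x y)
    (hsymm : ∀ x y, s y x = starRingEnd ℂ (s x y)) (hdefP : ∀ p ∈ P, s p p = 0 → p = 0)
    {X Xa : Module.End ℂ W} (hΘX : Θ * X = X) (hXXa : ∀ x y, s (X x) y = s x (Xa y)) {c : ℂ}
    (hXX : X * Xa * X = c • X) (hX0 : X ≠ 0) : starRingEnd ℂ c = c := by
  obtain ⟨w, hw⟩ : ∃ w, X w ≠ 0 := by
    by_contra h
    push Not at h
    exact hX0 (LinearMap.ext h)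
  have hXwP : X w ∈ P := (hP _).2 (by rw [← Module.End.mul_apply, hΘX])
  have hss : s (X w) (X w) ≠ 0 := fun h0 => hw (hdefP _ hXwP h0)
  have hreal : ∀ a, starRingEnd ℂ (s a a) = s a a := fun a => by rw [← hsymm]
  have h1 : s (X (Xa (X w))) (X w) = c * s (X w) (X w) := by
    have h := congrArg (fun T : Module.End ℂ W => T w) hXX
    simp only [Module.End.mul_apply, LinearMap.smul_apply] at h
    rw [h, hsmul]
  have h2 : s (X (Xa (X w))) (X w) = s (Xa (X w)) (Xa (X w)) := by rw [hXXa]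
  have h3 : starRingEnd ℂ (c * s (X w) (X w)) = c * s (X w) (X w) := by
    rw [← h1, h2, hreal]
  rw [map_mul, hreal] at h3
  exact mul_right_cancel₀ hss h3

/-- `[h_X, Y†] = −Y†`: the adjoint of (II), for `X, Y` raising with adjoints `X†, Y†` (lowering), `λ` real.
[cite: GoodmanWallachGTM255, §2.3.1] [cite: HoffmanKunze1971LinearAlgebra, §8.5] -/
theorem UnitaryLeviSetup.bracket_weight_neg_one {Θ : Module.End ℂ W} (hΘΘ : Θ * Θ = 1)
    {P Q : Submodule ℂ W} (hP : ∀ x, x ∈ P ↔ Θ x = x) (hQ : ∀ x, x ∈ Q ↔ Θ x = -x)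
    {s : W → W → ℂ} (hadd : ∀ x y z, s (x + y) z = s x z + s y z)
    (hsmul : ∀ (c : ℂ) (x y : W), s (c • x) y = c * s x y) (hsymm : ∀ x y, s y x = starRingEnd ℂ (s x y))
    (hPQ : ∀ p ∈ P, ∀ q ∈ Q, s p q = 0) (hdefP : ∀ p ∈ P, s p p = 0 → p = 0) (hdefQ : ∀ q ∈ Q, s q q = 0 → q = 0)
    {X Xa Y Ya : Module.End ℂ W} (hΘX : Θ * X = X) (hXΘ : X * Θ = -X) (hXXa : ∀ x y, s (X x) y = s x (Xa y))
    (hΘY : Θ * Y = Y) (hYΘ : Y * Θ = -Y) (hYYa : ∀ x y, s (Y x) y = s x (Ya y))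
    {c : ℂ} (hc : c ≠ 0) (hcreal : starRingEnd ℂ c = c) (hII : X * Xa * Y + Y * Xa * X = c • Y) :
    (c⁻¹ • (X * Xa - Xa * X)) * Ya - Ya * (c⁻¹ • (X * Xa - Xa * X)) = -Ya := by
  obtain ⟨haddr, -, -, -, -, hsubr, -⟩ := UnitaryTwoOdd.herm_right hadd hsymm
  have hnd := fun y => UnitaryTwoOdd.eq_zero_of_forall_left hadd hsymm hΘΘ hP hQ hPQ hdefP hdefQ (y := y)
  obtain ⟨hΘXa, hXaΘ⟩ := UnitaryTwoOdd.lower_of_adjoint hadd hsymm hΘΘ hP hQ hPQ hdefP hdefQ hΘX hXΘ hXXa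
  obtain ⟨hΘYa, hYaΘ⟩ := UnitaryTwoOdd.lower_of_adjoint hadd hsymm hΘΘ hP hQ hPQ hdefP hdefQ hΘY hYΘ hYYa
  have hXaX : ∀ x y, s (Xa x) y = s x (X y) := fun x y => by rw [hsymm, ← hXXa, ← hsymm]
  have hsmulr : ∀ (a : ℂ) x y, s x (a • y) = starRingEnd ℂ a * s x y := fun a x y => by
    rw [hsymm, hsmul, map_mul, ← hsymm]
  -- lowering ∘ lowering = 0
  have hkill : ∀ {S T : Module.End ℂ W}, S * Θ = S → Θ * T = -T → S * T = 0 := by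
    intro S T hS hT
    have h : S * T = -(S * T) := by
      calc S * T = S * Θ * T := by rw [hS]
        _ = S * (Θ * T) := by rw [mul_assoc]
        _ = -(S * T) := by rw [hT, mul_neg]
    have h2 : (2 : ℂ) • (S * T) = 0 := by rw [two_smul]; nth_rewrite 2 [h]; rw [add_neg_cancel]
    exact (smul_eq_zero.1 h2).resolve_left two_ne_zero
  have hXaYa : Xa * Ya = 0 := hkill hXaΘ hΘYa
  have hYaXa : Ya * Xa = 0 := hkill hYaΘ hΘXa
  -- the adjoint of (II): `Ya X Xa + Xa X Ya = c Ya`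
  have hIIa : Ya * X * Xa + Xa * X * Ya = c • Ya := by
    refine LinearMap.ext fun y => ?_
    rw [← sub_eq_zero, ← LinearMap.sub_apply]
    refine hnd _ fun x => ?_
    rw [LinearMap.sub_apply, hsubr, LinearMap.add_apply, haddr, LinearMap.smul_apply, hsmulr, hcreal]
    simp only [Module.End.mul_apply]
    rw [← hYYa, ← hXaX, ← hXXa, ← hXXa, ← hXaX, ← hYYa, ← hadd, ← hsmul]
    have h := congrArg (fun T : Module.End ℂ W => T x) hII
    simp only [LinearMap.add_apply, Module.End.mul_apply, LinearMap.smul_apply] at h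
    rw [h, hsmul, hsmul, hYYa, sub_self]
  rw [smul_mul_assoc, mul_smul_comm, ← smul_sub, sub_mul, mul_sub, mul_assoc X Xa Ya, hXaYa, mul_zero, zero_sub,
    ← mul_assoc Ya Xa X, hYaXa, zero_mul, sub_zero, ← mul_assoc Ya X Xa, ← neg_add', add_comm, hIIa, smul_neg,
    smul_smul, inv_mul_cancel₀ hc, one_smul]

end HodgeStructure

end Literature.AlgebraicGeometry.Motives

end
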